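import Mathlib
import Literature.Analysis.FluidPDE.VorticityCalculus
import Summits.NavierStokesRegularity.NavierStokesRegularity.Theorems.ThreadingFluxHorizonTowerDefs
import HarnessLib

/-!
# Crux `PoloidalLiouville` (stmt-NavierStokesRegularity-1222, W1), crux idea «horizon-threading-tower» / «precession-gap» (ns-idea-15):
# BLOW-DOWN LIMITS INHERIT THE KINEMATICS — a `C¹` blow-down limit of a divergence-free slice unthreaded about `x₀`
# is divergence free and unthreaded about the origin

Support file (`--supports stmt-NavierStokesRegularity-1222`, helper).  Experiment cell `ns-wall-extremal`, width hand
ns-wall-eng-4 g4.  0 kit.  A small bookkeeping lemma in the currency of the horizon card's Theorems-side twin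
`HorizonTower.IsBlowdownLimit` (`ThreadingFluxHorizonTowerDefs` l.176): the hypotheses «`div U = 0` off `x₀`» and «`⟪curl U x, x − x₀⟫ = 0`
off `x₀`» that `HorizonTowerZonality`, `OrderOneSphereEuler`, (J) `ConicalSteadyEulerRigidity` … place on a horizon profile `U` are
INHERITED from the slice whenever `U` is a `C¹` blow-down limit of a divergence-free slice unthreaded about `x₀` (orders 0 and 1 of the
blow-down convergence tested on the compact `{z}`; `div` and `curl` are linear in the first derivative, and
`⟪z, curl Uₖ z⟫ = ⟪xₖ − x₀, curl w xₖ⟫`, `div Uₖ z = λₖ div w xₖ` at `xₖ = x₀ + λₖ z`).  Used implicitly inside (J′)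
`Precession.steadyHorizonRigidity` and (J″) `Precession.precessingHorizonEquivariance`; recorded here once as a named lemma.

HONEST FRAME: kinematic bookkeeping about hypothetical scale-free far fields; `PoloidalLiouville` (1222) and NS regularity stay OPEN.
-/

-- the summit and its single problem share the name (D-0017 nested layout)
set_option linter.dupNamespace false

noncomputable section

namespace Summit.NavierStokesRegularity.NavierStokesRegularity.Theorems.PoloidalLiouville.HorizonTower

open Set Function Filter Topology Metric
open scoped Topology RealInnerProductSpace Laplacian ContDiff
open Literature.Analysis.FluidPDE

/-- **Blow-down limits inherit the kinematics.**  Let `w ∈ C¹(ℝ³)` be divergence free and unthreaded about `x₀`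
(`⟪x − x₀, curl w x⟫ = 0` for all `x`), and let `(U, P)` be a blow-down limit of `(w, q)` about `x₀` in the sense of
`IsBlowdownLimit` with `U ∈ C¹(ℝ³ ∖ {0})`.  Then `div U = 0` and `⟪z, curl U z⟫ = 0` for every `z ≠ 0`. -/
theorem blowdown_divFree_unthreaded (w : E3 → E3) (q : E3 → ℝ) (x₀ : E3) (U : E3 → E3) (P : E3 → ℝ)
    (hw : ContDiff ℝ 1 w) (hdiv : ∀ x, VectorCalculus.divergence w x = 0) (hun : ∀ x, inner ℝ (x - x₀) (curl w x) = 0)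
    (hU : ContDiffOn ℝ 1 U {0}ᶜ) (hbd : IsBlowdownLimit w q x₀ U P) :
    (∀ z : E3, z ≠ 0 → VectorCalculus.divergence U z = 0) ∧ ∀ z : E3, z ≠ 0 → inner ℝ z (curl U z) = 0 := by
  obtain ⟨lam, -, -, hlimV, -⟩ := hbd
  have hopen : IsOpen ({0}ᶜ : Set E3) := isOpen_compl_singleton
  have hVd : ∀ x, DifferentiableAt ℝ w x := fun x => hw.differentiable (by simp) x
  /- the rescaled fields `wₖ y = w (x₀ + λₖ y)` and their first derivatives -/
  set Vk : ℕ → E3 → E3 := fun k y => w (x₀ + lam k • y) with hVk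
  have hA : ∀ (k : ℕ) (y : E3), HasFDerivAt (fun z : E3 => x₀ + lam k • z) (lam k • ContinuousLinearMap.id ℝ E3) y :=
    fun k y => ((hasFDerivAt_id y).const_smul (lam k)).const_add x₀
  have hDVk : ∀ (k : ℕ) (y : E3), HasFDerivAt (Vk k) (lam k • fderiv ℝ w (x₀ + lam k • y)) y := by
    intro k y
    have h := (hVd (x₀ + lam k • y)).hasFDerivAt.comp y (hA k y)
    have e : (fderiv ℝ w (x₀ + lam k • y)).comp (lam k • ContinuousLinearMap.id ℝ E3)
        = lam k • fderiv ℝ w (x₀ + lam k • y) := by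
      ext v; simp
    rw [e] at h
    exact h
  /- pointwise limits at a fixed `z ≠ 0`, read off the blow-down convergence on the compact `{z}` -/
  have hptV : ∀ z : E3, z ≠ 0 → ∀ j ≤ 6,
      Tendsto (fun k => ‖iteratedFDeriv ℝ j (fun y : E3 => w (x₀ + lam k • y) - U y) z‖) atTop (𝓝 0) := by
    intro z hz j hj
    have h0 : (0 : E3) ∉ ({z} : Set E3) := by
      rw [Set.mem_singleton_iff]; exact fun h => hz h.symm
    have h := hlimV {z} isCompact_singleton h0 j hj
    simpa only [Set.image_singleton, csSup_singleton] using h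
  have happly : ∀ {L : ℕ → E3 →L[ℝ] E3} {v : ℕ → E3} {L₀ : E3 →L[ℝ] E3} {v₀ : E3},
      Tendsto L atTop (𝓝 L₀) → Tendsto v atTop (𝓝 v₀) → Tendsto (fun k => L k (v k)) atTop (𝓝 (L₀ v₀)) := by
    intro L v L₀ v₀ hL hv
    have hc : Continuous fun q : (E3 →L[ℝ] E3) × E3 => q.1 q.2 := isBoundedBilinearMap_apply.continuous
    exact (hc.tendsto (L₀, v₀)).comp (hL.prodMk_nhds hv)
  set e : OrthonormalBasis (Fin 3) ℝ E3 := EuclideanSpace.basisFun (Fin 3) ℝ with he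
  have hL1 : ∀ z : E3, z ≠ 0 → Tendsto (fun k => fderiv ℝ (Vk k) z) atTop (𝓝 (fderiv ℝ U z)) := by
    intro z hz
    have hUd : DifferentiableAt ℝ U z := ((hU z hz).contDiffAt (hopen.mem_nhds hz)).differentiableAt (by norm_num)
    rw [tendsto_iff_norm_sub_tendsto_zero]
    have h := hptV z hz 1 (by norm_num)
    refine h.congr fun k => ?_
    rw [← norm_iteratedFDeriv_fderiv, norm_iteratedFDeriv_zero,
      fderiv_fun_sub ((hDVk k z).differentiableAt) hUd]
  refine ⟨fun z hz => ?_, fun z hz => ?_⟩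
  · have hlim : Tendsto (fun k => VectorCalculus.divergence (Vk k) z) atTop (𝓝 (VectorCalculus.divergence U z)) := by
      simp only [divergence_eq_sum_inner_fderiv e]
      exact tendsto_finsetSum _ fun i _ => tendsto_const_nhds.inner (happly (hL1 z hz) tendsto_const_nhds)
    have hzero : ∀ k, VectorCalculus.divergence (Vk k) z = 0 := by
      intro k
      rw [divergence_eq_sum_inner_fderiv e, (hDVk k z).fderiv]
      have h := hdiv (x₀ + lam k • z)
      rw [divergence_eq_sum_inner_fderiv e] at h
      simp only [smul_apply, inner_smul_right, ← Finset.mul_sum, h, mul_zero]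
    exact tendsto_nhds_unique hlim (tendsto_const_nhds.congr fun k => (hzero k).symm)
  · have hlim : Tendsto (fun k => inner ℝ z (curl (Vk k) z)) atTop (𝓝 (inner ℝ z (curl U z))) := by
      have hc : Tendsto (fun k => curl (Vk k) z) atTop (𝓝 (curl U z)) := by
        simp only [curl_eq_curlCLM]
        exact (curlCLM.continuous.tendsto _).comp (hL1 z hz)
      exact tendsto_const_nhds.inner hc
    have hzero : ∀ k, inner ℝ z (curl (Vk k) z) = 0 := by
      intro k
      rw [curl_eq_curlCLM, (hDVk k z).fderiv, map_smul, ← curl_eq_curlCLM, inner_smul_right, ← real_inner_smul_left]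
      have h := hun (x₀ + lam k • z)
      rwa [add_sub_cancel_left] at h
    exact tendsto_nhds_unique hlim (tendsto_const_nhds.congr fun k => (hzero k).symm)

end Summit.NavierStokesRegularity.NavierStokesRegularity.Theorems.PoloidalLiouville.HorizonTower

end
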